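import Summits.ValiantsHypothesis.ValiantsHypothesis.Theorems.DepthWindowHomRel
import Summits.ValiantsHypothesis.ValiantsHypothesis.Theorems.DepthWindowHomSubst
import Summits.ValiantsHypothesis.ValiantsHypothesis.Theorems.DepthWindowHomBandValues
import Literature.Computability.AlgebraicComplexity.CircuitDepth
import HarnessLib

/-!
# `HomRelStacks` — stacking homogenised band blocks (route `DepthWindow`, crux `HomSubReach`)

This file PROVES the second-layer statement `HomRelStacks` of
`Theorems/DepthWindowHomRel.lean`: a relative block lemma `HomRel kk j` (every product-depth-`kk`
block over weighted variables has an every-gate-weighted-homogeneous version of product-depth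
`≤ j` and size `poly · 2^{O(d²)}` outputting all weighted components of degree `≤ d` of all its
gates) implies homogenisation of arbitrary circuits at slope `j / kk`:
`HomAt j kk j (3a+1)`.  Consequently the crux `HomSubReach` (`= HomSlope75`) follows from ANY
block lemma `HomRel kk j` with `5 j ≤ 7 kk` (`homSubReach_of_homRel`), reducing the crux to the
named block lemmas `HomRel 2 2`, `HomRel 3 4`, `HomRel 5 7`.

Proof: cut the circuit into bands of `kk` consecutive product levels (`DepthWindowHomBands`),
homogenise band `b` with `HomRel` over the placeholder variables `y_{i,e}` (weight `e+1`) standing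
for the components of lower-band gate values, and substitute the already-built homogeneous
operands for the placeholders (`DepthWindowHomSubst`, graded substitution keeps every gate
homogeneous; `DepthWindowHomBandValues`, the block reproduces the components).  Depth adds `j`
per band, size adds one block per band.

[cite: LimayeSrinivasanTavenas2025, Lemma 11, Lemma 19, Lemma 20] [cite: Burgisser2000, Def. 2.1]
[cite: LST2021, §2] [cite: BhargavDuttaSaxena2024, Thm. 1.4]
-/

set_option linter.dupNamespace false

namespace Summit.ValiantsHypothesis.ValiantsHypothesis.Theorems.DepthWindow

open MvPolynomial Literature.Computability.AlgebraicComplexity ArithCircuit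
open Literature.Computability.AlgebraicComplexity.DepthReduction

/-- Substituted operands reference the extended prefix. [cite: Burgisser2000, Def. 2.1] -/
theorem refsBelow_substShift {k : Type*} [CommSemiring k] {σ τ : Type*} (θ : τ → Operand k σ)
    (L m : ℕ) (hθ : ∀ t, (θ t).RefsBelow L) :
    ∀ u : Operand k τ, u.RefsBelow m → (Operand.substShift θ L u).RefsBelow (L + m)
  | .var t, _ => Operand.refsBelow_mono (Nat.le_add_right L m) (hθ t)
  | .const _, _ => trivial
  | .gate j, hj => by
      show L + j < L + m
      exact Nat.add_lt_add_left hj L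

variable {σ : Type}

/-- **Stacking invariant.**  After processing the bands `< B` of the circuit `G` we have a gate
list `Acc` with every value homogeneous, of length `≤ B · S`, and operands `O i e` computing the
degree-`e` component of the value of every gate `i` of band `< B`, at product-depth `≤ j · B`.
[cite: LimayeSrinivasanTavenas2025, Lemma 20] -/
theorem stack_inv {kk j a : ℕ} (hk : 0 < kk)
    (R : ∀ (τ : Type) [Fintype τ] (w : τ → ℕ), (∀ t, 1 ≤ w t) → ∀ (d : ℕ)
      (Φ : List (Gate ℂ τ)), (∀ n ∈ gateWDepths prodWeight Φ, n ≤ kk) →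
      ∃ (Ψ : List (Gate ℂ τ)) (out : ℕ → ℕ → Operand ℂ τ),
        (∀ g ∈ gateValues Ψ, ∃ e : ℕ, IsWeightedHomogeneous w g e) ∧
        (∀ n ∈ gateWDepths prodWeight Ψ, n ≤ j) ∧
        Ψ.length ≤ (Φ.length + Fintype.card τ + d + 2) ^ a * 2 ^ (a * d * d) ∧
        ∀ i e : ℕ, i < Φ.length → e ≤ d → (out i e).RefsBelow Ψ.length ∧
          (out i e).eval (gateValues Ψ) = weightedHomogeneousComponent w e ((gateValues Φ).getD i 0))
    [Fintype σ] (d : ℕ) (G : List (Gate ℂ σ)) :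
    ∀ B : ℕ, ∃ (Acc : List (Gate ℂ σ)) (O : ℕ → ℕ → Operand ℂ σ),
      (∀ g ∈ gateValues Acc, ∃ e : ℕ, g.IsHomogeneous e) ∧
      Acc.length ≤ B * ((2 * G.length + (Fintype.card σ + G.length * d) + d + 2) ^ a * 2 ^ (a * d * d)) ∧
      ∀ i < G.length, bandOf kk (gateWDepths prodWeight G) i < B → ∀ e ≤ d,
        (O i e).RefsBelow Acc.length ∧
        (O i e).eval (gateValues Acc) =
          weightedHomogeneousComponent (1 : σ → ℕ) e ((gateValues G).getD i 0) ∧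
        (O i e).depthIn (gateWDepths prodWeight Acc) ≤ j * B := by
  intro B
  induction B with
  | zero =>
      exact ⟨[], fun _ _ => .const 0, by simp [gateValues], by simp,
        fun i _ hb => absurd hb (Nat.not_lt_zero _)⟩
  | succ B ih =>
      obtain ⟨Acc, O, hhom, hlen, hO⟩ := ih
      set n := G.length with hn
      set ds := gateWDepths prodWeight G with hds
      set vals := gateValues G with hvals
      set S := (2 * n + (Fintype.card σ + n * d) + d + 2) ^ a * 2 ^ (a * d * d) with hS
      -- the band-`B` block and its homogenised version
      set Φ := bandBlock kk B n d ds vals G with hΦ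
      have hΦdepth : ∀ x ∈ gateWDepths prodWeight Φ, x ≤ kk := gateWDepths_bandBlock_le B d vals hk G
      obtain ⟨Ψ, out, hΨhom, hΨdepth, hΨlen, hout⟩ :=
        R (σ ⊕ (Fin n × Fin d)) (bandW n d) (bandW_pos n d) d Φ hΦdepth
      have hΦlen : Φ.length = n + n := by rw [hΦ, length_bandBlock]
      have hΨlen' : Ψ.length ≤ S := by
        have hcard : Fintype.card (σ ⊕ (Fin n × Fin d)) = Fintype.card σ + n * d := by
          simp [Fintype.card_sum, Fintype.card_prod, Fintype.card_fin]
        rw [hΦlen, hcard] at hΨlen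
        rw [hS, two_mul]
        exact hΨlen
      -- the substitution of the placeholders by the operands already built
      set θ : σ ⊕ (Fin n × Fin d) → Operand ℂ σ := Sum.elim Operand.var
        (fun p => if bandOf kk ds p.1 < B then O p.1 ((p.2 : ℕ) + 1) else Operand.const 0) with hθdef
      have hθ : ∀ t, (θ t).RefsBelow Acc.length := by
        rintro (x | p)
        · trivial
        · simp only [hθdef, Sum.elim_inr]
          split_ifs with hb
          · exact (hO p.1 p.1.isLt hb _ (by have := p.2.isLt; omega)).1
          · trivial
      have hM : ∀ t, (θ t).depthIn (gateWDepths prodWeight Acc) ≤ j * B := by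
        rintro (x | p)
        · exact Nat.zero_le _
        · simp only [hθdef, Sum.elim_inr]
          split_ifs with hb
          · exact (hO p.1 p.1.isLt hb _ (by have := p.2.isLt; omega)).2.2
          · exact Nat.zero_le _
      have hΘ : (fun t => (θ t).eval (gateValues Acc)) = bandΘ kk B n d ds vals := by
        funext t
        rcases t with x | p
        · rfl
        · simp only [hθdef, Sum.elim_inr, bandΘ_inr]
          split_ifs with hb
          · exact (hO p.1 p.1.isLt hb _ (by have := p.2.isLt; omega)).2.1
          · simp [Operand.eval]
      have hsubst : ∀ q, substMap θ (gateValues Acc) q = aeval (bandΘ kk B n d ds vals) q := by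
        intro q; unfold substMap; rw [hΘ]
      have hgraded := bandΘ_isHomogeneous kk B n d ds vals
      have hLA : (gateValues Acc).length = Acc.length := gateValues_length Acc
      have hDA : (gateWDepths prodWeight Acc).length = Acc.length := gateWDepths_length _ Acc
      -- the new accumulated list and output operands
      refine ⟨Acc ++ Ψ.map (Gate.substShift θ Acc.length),
        fun i e => if bandOf kk ds i < B then O i e else Operand.substShift θ Acc.length (out (n + i) e),
        ?_, ?_, ?_⟩
      · -- every value homogeneous
        intro g hg
        rw [gateValues_append_substShift θ Acc hθ Ψ, List.mem_append, List.mem_map] at hg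
        rcases hg with hg | ⟨q, hq, rfl⟩
        · exact hhom g hg
        · obtain ⟨e', he'⟩ := hΨhom q hq
          refine ⟨e', ?_⟩
          rw [hsubst]
          exact IsWeightedHomogeneous.aeval_graded (bandW n d) _ hgraded he'
      · -- size
        rw [List.length_append, List.length_map, Nat.succ_mul]
        exact Nat.add_le_add hlen hΨlen'
      · -- the output operands
        intro i hi hband e he
        dsimp only
        by_cases hb : bandOf kk ds i < B
        · rw [if_pos hb]
          obtain ⟨hR, hE, hDp⟩ := hO i hi hb e he
          refine ⟨?_, ?_, ?_⟩
          · exact Operand.refsBelow_mono (by simp) hR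
          · rw [gateValues_append_substShift θ Acc hθ Ψ,
              operand_eval_append_of_refsBelow _ _ (hLA.symm ▸ hR), hE]
          · obtain ⟨X, hX, -⟩ := gateWDepths_prefix prodWeight Acc (Ψ.map (Gate.substShift θ Acc.length))
            rw [hX, depthIn_append_of_refsBelow _ _ (hDA.symm ▸ hR), Nat.mul_succ]
            exact hDp.trans (Nat.le_add_right _ _)
        · rw [if_neg hb]
          have hbe : bandOf kk ds i = B := by omega
          obtain ⟨hoR, hoE⟩ := hout (n + i) e (by rw [hΦlen]; omega) he
          refine ⟨?_, ?_, ?_⟩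
          · rw [List.length_append, List.length_map]
            exact refsBelow_substShift θ Acc.length Ψ.length hθ _ hoR
          · rw [gateValues_append_substShift θ Acc hθ Ψ]
            have key := eval_substShift θ (gateValues Acc) (hLA.symm ▸ hθ) (gateValues Ψ) (out (n + i) e)
            rw [hLA] at key
            rw [key, hoE, hsubst, aeval_graded_weightedHomogeneousComponent (bandW n d) _ hgraded e]
            exact bandBlock_values kk B d G hi hbe he
          · obtain ⟨Dnew, hDnew, hDlen⟩ :=
              gateWDepths_prefix prodWeight Acc (Ψ.map (Gate.substShift θ Acc.length))
            rw [List.length_map] at hDlen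
            have hnew : ∀ i' < (gateWDepths prodWeight Ψ).length,
                Dnew.getD i' 0 ≤ (gateWDepths prodWeight Ψ).getD i' 0 + j * B := by
              intro i' hi'
              rw [gateWDepths_length] at hi'
              have h := getD_gateWDepths_append_substShift_le θ Acc (j * B) hθ hM Ψ i' hi'
              rwa [hDnew, ← hDA, getD_append_length_add] at h
            have key := depthIn_substShift_le θ (gateWDepths prodWeight Acc) (gateWDepths prodWeight Ψ)
              Dnew (j * B) (hDA.symm ▸ hθ) hM (by rw [hDlen, gateWDepths_length]) hnew (out (n + i) e)
            rw [hDA] at key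
            rw [hDnew, Nat.mul_succ]
            refine key.trans (Nat.add_le_add_right (depthIn_le hΨdepth _) _ |>.trans (by omega))

/-- Size arithmetic of the stacking: `n` blocks of the `HomRel` size fit the `HomAt` budget with
exponent `3a + 1` (for `d ≥ 1`). -/
theorem stack_size_le (n c d a : ℕ) (hd : 1 ≤ d) :
    n * ((2 * n + (c + n * d) + d + 2) ^ a * 2 ^ (a * d * d)) ≤
      (n + c + 2) ^ (3 * a + 1) * 2 ^ ((3 * a + 1) * d * d) := by
  set X := n + c + 2 with hX
  have hX1 : 1 ≤ X := by omega
  have h1 : 2 * n + (c + n * d) + d + 2 ≤ X * (d + 2) := by rw [hX]; nlinarith [Nat.zero_le (c * d)]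
  have h3 : d + 2 ≤ 2 ^ (d + 1) := by
    have := Nat.succ_le_of_lt (@Nat.lt_two_pow_self d)
    rw [pow_succ]; omega
  have h2 : (2 * n + (c + n * d) + d + 2) ^ a ≤ X ^ a * 2 ^ ((d + 1) * a) := by
    refine (Nat.pow_le_pow_left h1 a).trans ?_
    rw [mul_pow, pow_mul]
    exact Nat.mul_le_mul_left _ (Nat.pow_le_pow_left h3 a)
  have h5 : n ≤ X := by omega
  have hdd : d + 1 ≤ 2 * (d * d) := by nlinarith
  have h6 : (d + 1) * a + a * d * d ≤ (3 * a + 1) * d * d := by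
    have := Nat.mul_le_mul_right a hdd
    nlinarith [this, Nat.zero_le (d * d)]
  calc n * ((2 * n + (c + n * d) + d + 2) ^ a * 2 ^ (a * d * d))
      ≤ X * (X ^ a * 2 ^ ((d + 1) * a) * 2 ^ (a * d * d)) :=
        Nat.mul_le_mul h5 (Nat.mul_le_mul_right _ h2)
    _ = X ^ (a + 1) * 2 ^ ((d + 1) * a + a * d * d) := by rw [pow_succ, pow_add]; ring
    _ ≤ X ^ (3 * a + 1) * 2 ^ ((3 * a + 1) * d * d) :=
        Nat.mul_le_mul (Nat.pow_le_pow_right hX1 (by omega)) (Nat.pow_le_pow_right (by norm_num) h6)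

/-- Depth arithmetic of the stacking: `j · (band + 1) ≤ j · Δ / kk + j`. -/
theorem stack_depth_le (j kk Δ : ℕ) : j * ((Δ - 1) / kk + 1) ≤ j * Δ / kk + j := by
  rw [Nat.mul_succ]
  refine Nat.add_le_add_right ((Nat.mul_div_le_mul_div_assoc j (Δ - 1) kk).trans ?_) j
  exact Nat.div_le_div_right (Nat.mul_le_mul_left j (Nat.sub_le Δ 1))

/-- **`HomRelStacks` holds**: a relative block lemma `HomRel kk j` stacks to homogenisation at
slope `j / kk` (`HomAt j kk j (3a+1)`). [cite: LimayeSrinivasanTavenas2025, Lemma 19, Lemma 20] -/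
theorem homRelStacks : HomRelStacks := by
  intro kk j hk hRel
  obtain ⟨a, R⟩ := hRel
  refine ⟨j, 3 * a + 1, ?_⟩
  intro σ _ d f hf D hD
  have hDf : D.output.eval (gateValues D.gates) = f := hD
  -- degree 0: a constant
  by_cases hd : d = 0
  · subst hd
    refine ⟨⟨[], .const (coeff 0 f)⟩, ?_, by simp [gateValues], Nat.zero_le _, Nat.zero_le _⟩
    show C (coeff 0 f) = f
    -- a homogeneous polynomial of degree `0` is a constant
    have h1 : weightedHomogeneousComponent (1 : σ → ℕ) 0 f = f := hf.weightedHomogeneousComponent_same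
    have h0 : weightedHomogeneousComponent (1 : σ → ℕ) 0 f = C (coeff 0 f) :=
      weightedHomogeneousComponent_zero f (fun _ => one_ne_zero)
    rw [← h0, h1]
  have hd1 : 1 ≤ d := Nat.one_le_iff_ne_zero.mpr hd
  -- the output operand
  cases hout : D.output with
  | var x =>
      refine ⟨⟨[], .var x⟩, ?_, by simp [gateValues], Nat.zero_le _, Nat.zero_le _⟩
      show (Operand.var x : Operand ℂ σ).eval (gateValues []) = f
      rw [← hDf, hout]; rfl
  | const c =>
      refine ⟨⟨[], .const c⟩, ?_, by simp [gateValues], Nat.zero_le _, Nat.zero_le _⟩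
      show (Operand.const c : Operand ℂ σ).eval (gateValues []) = f
      rw [← hDf, hout]; rfl
  | gate i₀ =>
      by_cases hi₀ : i₀ < D.gates.length
      swap
      · -- junk output reference: `f = 0`
        refine ⟨⟨[], .const 0⟩, ?_, by simp [gateValues], Nat.zero_le _, Nat.zero_le _⟩
        show (Operand.const 0 : Operand ℂ σ).eval (gateValues []) = f
        rw [← hDf, hout]
        show C 0 = (gateValues D.gates).getD i₀ 0
        rw [List.getD_eq_default _ _ (by rw [gateValues_length]; omega), C_0]
      -- main case
      set n := D.gates.length with hn
      set Δ := (gateWDepths prodWeight D.gates).getD i₀ 0 with hΔ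
      have hpd : D.productDepth = Δ := by
        show D.output.depthIn (gateWDepths prodWeight D.gates) = Δ
        rw [hout]; rfl
      obtain ⟨Acc, O, hhom, hlen, hO⟩ :=
        stack_inv hk R d D.gates (bandOf kk (gateWDepths prodWeight D.gates) i₀ + 1)
      obtain ⟨-, hE, hDp⟩ := hO i₀ hi₀ (Nat.lt_succ_self _) d le_rfl
      refine ⟨⟨Acc, O i₀ d⟩, ?_, hhom, ?_, ?_⟩
      · show (O i₀ d).eval (gateValues Acc) = f
        rw [hE]
        have hval : (gateValues D.gates).getD i₀ 0 = f := by rw [← hDf, hout]; rfl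
        rw [hval]
        exact hf.weightedHomogeneousComponent_same
      · show (O i₀ d).depthIn (gateWDepths prodWeight Acc) ≤ j * D.productDepth / kk + j
        rw [hpd]
        exact hDp.trans (stack_depth_le j kk Δ)
      · show Acc.length ≤ (n + Fintype.card σ + 2) ^ (3 * a + 1) * 2 ^ ((3 * a + 1) * d * d)
        have hband : bandOf kk (gateWDepths prodWeight D.gates) i₀ + 1 ≤ n := by
          have h1 : Δ ≤ i₀ + 1 := getD_gateWDepths_le_succ D.gates i₀
          have h2 : bandOf kk (gateWDepths prodWeight D.gates) i₀ ≤ Δ - 1 := Nat.div_le_self _ _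
          omega
        refine hlen.trans ((Nat.mul_le_mul_right _ hband).trans ?_)
        exact stack_size_le n (Fintype.card σ) d a hd1

/-- **The crux from any admissible block lemma**: `HomRel kk j` with `5 j ≤ 7 kk` (`kk ≥ 1`)
implies `HomSubReach`'s kernel form `HomSlope75`. [cite: LimayeSrinivasanTavenas2025, Lemma 11]
[cite: BhargavDuttaSaxena2024, Thm. 1.4] -/
theorem homSlope75_of_homRel' {kk j : ℕ} (hk : 0 < kk) (hkj : 5 * j ≤ 7 * kk) (h : HomRel kk j) :
    HomSlope75 :=
  homSlope75_of_homRel homRelStacks hk hkj h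

/-- Unconditional entry points: each named block lemma alone now closes the crux. -/
theorem homSlope75_of_homRel_2_2' (h : HomRel 2 2) : HomSlope75 := homSlope75_of_homRel_2_2 homRelStacks h

/-- `HomRel 3 4` alone closes the crux. -/
theorem homSlope75_of_homRel_3_4' (h : HomRel 3 4) : HomSlope75 := homSlope75_of_homRel_3_4 homRelStacks h

/-- `HomRel 5 7` alone closes the crux. -/
theorem homSlope75_of_homRel_5_7' (h : HomRel 5 7) : HomSlope75 := homSlope75_of_homRel_5_7 homRelStacks h

end Summit.ValiantsHypothesis.ValiantsHypothesis.Theorems.DepthWindow
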